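import Summits.QuantumFields.YangMills.Theorems.SwapVirialDeficitSwapRingCeiling
import Summits.QuantumFields.YangMills.Theorems.SwapVirialDeficitSwapRingCeilingBoxTwisted
import Summits.QuantumFields.YangMills.Theorems.SwapVirialDeficitSwapRingSectorEvents
import Summits.QuantumFields.YangMills.Theorems.SwapVirialDeficitSigmaTwistedLetterCeiling
import Summits.QuantumFields.YangMills.Theorems.SwapVirialDeficitSwapRingSectorLaplace
import Summits.QuantumFields.YangMills.Theorems.ToronValleyVolumePeriodicRingCeiling
import HarnessLib

/-!
# The fixed-`L` swap CEILING, all eight seam sectors: `μ_L{F^S_z ≤ u} ≤ C_{L,z}·u^{9L⁴−1}`, hence `⟨S⟩_β ≍ β^{−1/2}/log β` at fixed `L`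
# (brick (B-v-z) of w2 g54's swap-ceiling plan, LEAD ym-line-sfw-p2 g93's 06:58/07:01/07:29Z rulings of record; free-hands support of
# ⟨stmt-QuantumFields-24197⟩ `SwapVirialDeficit.SwapGluedStiffness`)

Assembly of the cell's chain, sector by sector (`z ∈ (ℤ/2)³` the seam sector of the σ-glued ring):
* the SIGNED box ✓`SwapRingTwisted.swapBox_of_swapRingDeficit_le` (fcl-p3 g43): on `{F^S_z ≤ u}` the tree-gauged history has its four leaders in
  the signed Frobenius event `E^F_z(52L³√u)`, every other coordinate in a Frobenius ball of radius `48L³√u`;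
* the sector Fubini ✓`SwapRing.ringMeasure_real_swapDeficit_le_le_box_of_box` (w3 g61): `μ_L{F^S_z ≤ u} ≤ Haar⁴(E^F_z(s))·ballVol(t₂)^{6L⁴−3}`;
* the signed four-leader ceilings ✓`SwapRingSectors.haar_real_signedEvent_le` (fcl-p3 g43; `z 2 = 1` from w2 g54's ✓(B-iii), odd sectors EMPTY
  by w2's ✓(B-iv), even sectors by reflection onto the principal event) with its one hypothesis `hceil0` DISCHARGED by LEAD g93's
  ✓`SigmaTwistedCeiling.haar_pi_sigmaTwisted_le` (`Haar⁴(E^σ_t) ≤ C·t⁷`): §1 `haar_real_signedEvent_le'`;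
* the small-ball volume ✓`PeriodicRingCeiling.ballVol_le_four_mul_cube` and the exponent count `7 + 3(6L⁴−3) = 2(9L⁴−1)`: §2
  ★★ `swap_sectorVolume_ceiling` — EXACTLY the hypothesis `hvol` of ✓`SwapRing.swap_twistTrace_ceiling_of_sectorVolumes`;
* §3 ★★★ `swap_twistTrace_ceiling` (`Z^S_{L,β} ≤ C_L·e^{12βL⁴}/β^{9L⁴−1}`, all `β > 0`, NO logarithm), ★★★ `swap_twistRatio_ceiling` and
  ★★★ `swap_twistRatio_two_sided`: `κ₁·β^{−1/2}/log β ≤ ⟨S⟩_{L,β} = Z^S/Z ≤ κ₂·β^{−1/2}/log β` for `β ≥ β₀(L)` — the fixed-`L` prediction row of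
  w2 g54's census SWAP-STRATA (evidence #2 on ⟨23802⟩), now UNCONDITIONAL (✓`twistRatio_two_sided_of_sectorVolumes`).
HONEST LABEL: a FIXED-`L` statement with constants `exp(O(L⁴ log L))`; it is NOT the window-uniform ⟨24197⟩ `SwapGluedStiffness` / ⟨24194⟩ and says
nothing about ⟨24497⟩/⟨24196⟩ or any rung; the Yang–Mills mass gap is NOT proved; no summit is proved by a line.
Width seat ym-line-sfw-p2-w2 g55 (cell ym-idea-1, free hands; own crux ⟨22884⟩ blocked-on ⟨19935⟩), `--supports stmt-QuantumFields-24197`.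
THEOREMS ONLY (0 `def`, 0 `sorry`), standard axioms.  References: [cite: tHooft1979]; [cite: Luscher1983, §2]; [cite: Vanbaal2001];
[cite: Chatterjee2016, Lemma 9.3]; [folklore].
-/

set_option autoImplicit false

noncomputable section

open MeasureTheory Set
open scoped BigOperators ENNReal
open Literature.MathematicalPhysics.QuantumFieldTheory hiding SU2
open Literature.MathematicalPhysics.QuantumLattice

namespace Summit.QuantumFields.YangMills.Theorems.SwapVirialDeficit.SwapRing

open Summit.QuantumFields.YangMills.Theorems.FemtoTransferGap
open Summit.QuantumFields.YangMills.Theorems.FemtoTransferGap.TT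
open Summit.QuantumFields.YangMills.Theorems.VirialFluxGap.RingDeficit
open Summit.QuantumFields.YangMills.Theorems.SwapTwistDeficit.PeriodicRingFloor
open Summit.QuantumFields.YangMills.Theorems.ToronValleyVolume.PeriodicRingCeiling (ballVol_le_four_mul_cube)
open Summit.QuantumFields.YangMills.Theorems.SwapVirialDeficit.SwapRingTwisted (swapBox_of_swapRingDeficit_le)
open Summit.QuantumFields.YangMills.Theorems.SwapVirialDeficit.SwapRingSectors (haar_real_signedEvent_le)
open Summit.QuantumFields.YangMills.Theorems.SwapVirialDeficit.SigmaTwistedCeiling (haar_pi_sigmaTwisted_le)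

variable {L : ℕ} [NeZero L]

/-! ## §1 The signed four-leader ceilings, all eight sectors, unconditionally -/

/-- ★ **All eight signed four-leader events have product-Haar mass `≤ C_z·s⁷` on `(0, s₀(z)]`** — fcl-p3 g43's ✓`haar_real_signedEvent_le` with its
hypothesis `hceil0` discharged by LEAD g93's principal ceiling ✓`SigmaTwistedCeiling.haar_pi_sigmaTwisted_le`. [cite: tHooft1979] [cite: Luscher1983, §2] -/
theorem haar_real_signedEvent_le' (z : Fin 3 → Bool) :
    ∃ C : ℝ, 0 ≤ C ∧ ∃ s₀ : ℝ, 0 < s₀ ∧ ∀ s : ℝ, 0 < s → s ≤ s₀ →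
      (Measure.pi fun _ : Fin 4 => haarProbability SU2).real {C : Fin 4 → SU2 |
        (∀ μ ν : Fin 3, frobNorm (((C (Fin.castSucc μ) * C (Fin.castSucc ν) : SU2) : Matrix (Fin 2) (Fin 2) ℂ) -
          ((C (Fin.castSucc ν) * C (Fin.castSucc μ) : SU2) : Matrix (Fin 2) (Fin 2) ℂ)) ≤ s) ∧
        ∀ μ : Fin 3, frobNorm (((C (Fin.last 3) * C (Fin.castSucc (Equiv.swap (0 : Fin 3) 1 μ)) : SU2) : Matrix (Fin 2) (Fin 2) ℂ) -
          ((centreElem (z μ) * C (Fin.castSucc μ) * C (Fin.last 3) : SU2) : Matrix (Fin 2) (Fin 2) ℂ)) ≤ s} ≤ C * s ^ 7 := by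
  obtain ⟨C, hC, t₀, ht₀, h⟩ := haar_pi_sigmaTwisted_le
  exact haar_real_signedEvent_le ⟨C, hC.le, t₀, ht₀, h⟩ z

/-! ## §2 The per-sector volume ceiling `μ_L{F^S_z ≤ u} ≤ C·u^{9L⁴−1}` -/

omit [NeZero L] in
/-- The exponent count of the swap ceiling: seven powers of `√u` from the four-leader event and three from each of the `6L⁴ − 3` fluctuation balls make
`2(9L⁴ − 1)`. [folklore] -/
theorem seven_add_three_mul_eq (hL : 1 ≤ L) : 7 + 3 * (6 * L ^ 4 - 3) = 2 * (9 * L ^ 4 - 1) := by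
  have h1 : 1 ≤ L ^ 4 := Nat.one_le_pow _ _ hL
  obtain ⟨X, hX⟩ : ∃ X, L ^ 4 = X := ⟨_, rfl⟩
  rw [hX] at h1 ⊢
  omega

omit [NeZero L] in
/-- `(√u)⁷ · ((√u)³)^{6L⁴−3} = u^{9L⁴−1}` for `u ≥ 0`. [folklore] -/
theorem sqrt_pow_seven_mul_pow (hL : 1 ≤ L) {u : ℝ} (hu : 0 ≤ u) :
    Real.sqrt u ^ 7 * (Real.sqrt u ^ 3) ^ (6 * L ^ 4 - 3) = u ^ (9 * L ^ 4 - 1) := by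
  rw [← pow_mul, ← pow_add, seven_add_three_mul_eq hL, pow_mul, Real.sq_sqrt hu]

/-- ★★ **THE PER-SECTOR VOLUME CEILING OF THE σ-GLUED RING** — for every seam sector `z ∈ (ℤ/2)³` there are `C ≥ 0` and `u₀ > 0` with
`μ_L{F^S_z ≤ u} ≤ C·u^{9L⁴−1}` for `0 < u ≤ u₀`: the signed box (✓`swapBox_of_swapRingDeficit_le`, `s = 52L³√u`, `t₂ = 48L³√u`) through the sector
Fubini (✓`ringMeasure_real_swapDeficit_le_le_box_of_box`), the signed four-leader ceiling `≤ C_z·s⁷` (§1) and `ballVol(t₂) ≤ 4t₂³` for the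
`6L⁴ − 3` fluctuation coordinates.  This is VERBATIM the hypothesis `hvol` of ✓`swap_twistTrace_ceiling_of_sectorVolumes`.
[cite: tHooft1979] [cite: Luscher1983, §2] [cite: Chatterjee2016, Lemma 9.3] -/
theorem swap_sectorVolume_ceiling (z : Fin 3 → Bool) :
    ∃ C : ℝ, 0 ≤ C ∧ ∃ u₀ : ℝ, 0 < u₀ ∧ ∀ u : ℝ, 0 < u → u ≤ u₀ →
      (ringMeasure L).real {P | swapRingDeficit L z P ≤ u} ≤ C * u ^ (9 * L ^ 4 - 1) := by
  obtain ⟨C, hC, s₀, hs₀, hE⟩ := haar_real_signedEvent_le' z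
  have hL1 : 1 ≤ L := NeZero.one_le
  have hL : (0 : ℝ) < L := Nat.cast_pos.2 (NeZero.pos L)
  have hA : (0 : ℝ) < 52 * (L : ℝ) ^ 3 := by positivity
  -- the threshold: `52L³√u ≤ s₀` iff `u ≤ (s₀/(52L³))²`
  refine ⟨C * (52 * (L : ℝ) ^ 3) ^ 7 * (4 * (48 * (L : ℝ) ^ 3) ^ 3) ^ (6 * L ^ 4 - 3), by positivity,
    (s₀ / (52 * (L : ℝ) ^ 3)) ^ 2, by positivity, fun u hu hu₀ => ?_⟩
  set s : ℝ := 52 * (L : ℝ) ^ 3 * Real.sqrt u with hs_def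
  set t₂ : ℝ := 48 * (L : ℝ) ^ 3 * Real.sqrt u with ht₂_def
  have hsu : 0 < Real.sqrt u := Real.sqrt_pos.2 hu
  have hs : 0 < s := by positivity
  have ht₂ : 0 < t₂ := by positivity
  have hss₀ : s ≤ s₀ := by
    have h1 : Real.sqrt u ≤ s₀ / (52 * (L : ℝ) ^ 3) := by
      rw [← Real.sqrt_sq (div_pos hs₀ hA).le]
      exact Real.sqrt_le_sqrt hu₀
    calc s = 52 * (L : ℝ) ^ 3 * Real.sqrt u := rfl
      _ ≤ 52 * (L : ℝ) ^ 3 * (s₀ / (52 * (L : ℝ) ^ 3)) := mul_le_mul_of_nonneg_left h1 hA.le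
      _ = s₀ := mul_div_cancel₀ _ hA.ne'
  -- the sector Fubini fed with the signed box
  have hF := ringMeasure_real_swapDeficit_le_le_box_of_box (L := L) z
    (fun x : Site 3 L => centreElem (Bool.xor (z 0 && decide (x 0 ≠ 0)) (Bool.xor (z 1 && decide (x 1 ≠ 0)) (z 2 && decide (x 2 ≠ 0)))))
    (fun μ : Fin 3 => centreElem (z μ)) (s := s) (t₂ := t₂) (u := u)
    (fun w r g hle => swapBox_of_swapRingDeficit_le z u w r g hle)
  -- the four-leader factor and the fluctuation balls
  have hEs := hE s hs hss₀
  have hball : ballVol t₂ ^ (6 * L ^ 4 - 3) ≤ (4 * t₂ ^ 3) ^ (6 * L ^ 4 - 3) :=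
    pow_le_pow_left₀ (ballVol_nonneg _) (ballVol_le_four_mul_cube ht₂) _
  have hkey := sqrt_pow_seven_mul_pow hL1 hu.le
  calc (ringMeasure L).real {P | swapRingDeficit L z P ≤ u}
      ≤ _ := hF
    _ ≤ C * s ^ 7 * (4 * t₂ ^ 3) ^ (6 * L ^ 4 - 3) :=
        mul_le_mul hEs hball (pow_nonneg (ballVol_nonneg _) _) (by positivity)
    _ = C * (52 * (L : ℝ) ^ 3) ^ 7 * (4 * (48 * (L : ℝ) ^ 3) ^ 3) ^ (6 * L ^ 4 - 3) *
          (Real.sqrt u ^ 7 * (Real.sqrt u ^ 3) ^ (6 * L ^ 4 - 3)) := by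
        rw [hs_def, ht₂_def, mul_pow (52 * (L : ℝ) ^ 3), mul_pow (48 * (L : ℝ) ^ 3), ← mul_assoc (4 : ℝ), mul_pow (4 * _)]
        ring
    _ = C * (52 * (L : ℝ) ^ 3) ^ 7 * (4 * (48 * (L : ℝ) ^ 3) ^ 3) ^ (6 * L ^ 4 - 3) * u ^ (9 * L ^ 4 - 1) := by rw [hkey]

/-! ## §3 The swap-twisted trace ceiling and the two-sided twist-ratio law at fixed `L` -/

/-- ★★★ **`Z^S_{L,β} ≤ C_L·e^{12βL⁴}/β^{9L⁴−1}` for all `β > 0`** — the fixed-`L` CEILING of the σ-twisted partition function, NO logarithm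
(`(9L⁴−1) = (9·L⁴ − 3/2) + 1/2`: the σ-central zero-mode block costs `β^{−7/2}` against the periodic `β^{−3}·log β`).
✓`swap_twistTrace_ceiling_of_sectorVolumes` fed with §2. [cite: tHooft1979] [cite: Luscher1983, §2] [cite: Vanbaal2001] -/
theorem swap_twistTrace_ceiling (L : ℕ) [NeZero L] :
    ∃ C : ℝ, 0 < C ∧ ∀ β : ℝ, 0 < β →
      TT.twistTrace L β (2 * L) ≤ C * Real.exp (12 * β * (L : ℝ) ^ 4) * (β ^ (9 * L ^ 4 - 1))⁻¹ :=
  swap_twistTrace_ceiling_of_sectorVolumes (L := L) swap_sectorVolume_ceiling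

/-- ★★★ **`⟨S⟩_{L,β} ≤ κ_L·β^{−1/2}/log β` for `β ≥ β₀(L)`** (with the periodic floor ✓`PeriodicRingFloor.log_physTrace_floor`).
[cite: tHooft1979] [cite: Luscher1983, §2] [cite: Vanbaal2001] -/
theorem swap_twistRatio_ceiling (L : ℕ) [NeZero L] :
    ∃ κ : ℝ, 0 < κ ∧ ∃ β₀ : ℝ, ∀ β : ℝ, β₀ ≤ β →
      TT.twistTrace L β (2 * L) / TT.physTrace L β (2 * L) ≤ κ * (β ^ (-(1 / 2 : ℝ)) / Real.log β) :=
  twistRatio_ceiling_of_sectorVolumes (L := L) swap_sectorVolume_ceiling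

/-- ★★★ **THE FIXED-`L` TWO-SIDED LAW `⟨S⟩_{L,β} ≍ β^{−1/2}/log β`** (`β ≥ β₀(L)`; constants `exp(O(L⁴ log L))`): the prediction row of w2 g54's
census SWAP-STRATA for the swap-glued `SU(2)` femto ring `Hom(ℤ³ ⋊_σ ℤ, SU(2))` — central stratum `h¹ = 9`, local exponent `(9N−2)/2` without
logarithm, against the periodic ring's `β^{−(9N−3)/2}·log β`.  Lower half ✓`twistRatio_floor_of_exists` (w2 g54) with ✓`log_physTrace_ceiling`
(fcl-p3 g43) and ✓`swap_twistTrace_floor_rpow` (w3 g61); upper half §2 through ✓`twistRatio_two_sided_of_sectorVolumes` (w3 g61).  UNCONDITIONAL.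
[cite: tHooft1979] [cite: Luscher1983, §2] [cite: Vanbaal2001] -/
theorem swap_twistRatio_two_sided (L : ℕ) [NeZero L] :
    ∃ κ₁ : ℝ, 0 < κ₁ ∧ ∃ κ₂ : ℝ, 0 < κ₂ ∧ ∃ β₀ : ℝ, ∀ β : ℝ, β₀ ≤ β →
      κ₁ * (β ^ (-(1 / 2 : ℝ)) / Real.log β) ≤ TT.twistTrace L β (2 * L) / TT.physTrace L β (2 * L) ∧
        TT.twistTrace L β (2 * L) / TT.physTrace L β (2 * L) ≤ κ₂ * (β ^ (-(1 / 2 : ℝ)) / Real.log β) :=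
  twistRatio_two_sided_of_sectorVolumes (L := L) swap_sectorVolume_ceiling

end Summit.QuantumFields.YangMills.Theorems.SwapVirialDeficit.SwapRing

end
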